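import Mathlib
import Summits.ValiantsHypothesis.ValiantsHypothesis.Theorems.BarrierLeverPartitionMinorsHitByVPHiddenStatesPairBall
import Summits.ValiantsHypothesis.ValiantsHypothesis.Theorems.BarrierLeverPartitionMinorsHitByVPHiddenStatesShadowRankPairs

/-!
# Route BarrierLever — item `PartitionMinorsHitByVP` (stmt-ValiantsHypothesis-19717), line `hidden_states`:
# BP₂ ON THE WINDOW OF RECORD `[h²/4, h³/8]` IS FALSE FOR EVERY `h ≥ 24` (the tree's own `q = 2` pair law)

Helper file (`--supports stmt-ValiantsHypothesis-19717`; cell valiant-natproofs, rung V4, 𝒟-side door (c), line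
`hidden_states`, node #1 `stub_universalJoinWide`; prover seat val-np-p3 gen 21). Definition-free. Closes NO item — it REFUTES,
by name, the «theory target of record» of the block lane (planner rulings R52/R57: `∀ n, PairBall.Stmt.bp2 (h²/4) (h³/8) h n`,
kernel arrow `PairBallMix.universalJoinWide_of_bp2_range`, p719377) at every `h ≥ 24`, and records why NO polynomially scaled
window can carry it for all `h`.

THE OBSERVATION. `PairBall.Stmt.bp2 β₁ β₂ h n` (p717984) asks, for EVERY injective family `ℛ` of `n` nonempty rows, a block table
giving the complete pair block `{g_q, g_q + g_q'}_{q,q' ∈ B}` (`β₁ ≤ |B| ≤ β₂`) full column rank on `V_ℛ`. Take `F = 0` free states,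
`|B| = b`, `n = b + C(b,2)` and ALL rows of size `≤ 5`. The pair span bound `ShadowRank.det_eq_zero_pairs` (val-np-p3 g19, p707760;
`q = 2`, `s = 5`, `N = N₂(h) := 1 + h + C(h,2)`) makes the square block matrix SINGULAR FOR EVERY TABLE as soon as
`N₂(h) ≤ b` and `b + b·N₂(h) < n + C(N₂(h), 2)` (i.e. `(b − N₂)² > b + N₂`), provided `n ≤ Σ_{1≤j≤5} C(h,j)` rows of size `≤ 5`
exist (`not_bp2_of_pairLaw`). The band of such `b` is empty for `h ≤ 23` (which is why the censuses kit j330545–j331436, `h ≤ 16`,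
saw nothing) and NONEMPTY FROM `h = 24` ON, INSIDE the window: `b = 327, 353, 380, 408` at `h = 24, 25, 26, 27`
(`not_bp2_window_24` … `_27` — exactly the heights where the lane's «(h, r) table through h = 27» needed BP), and `b = C(h,2) + 3h + 1`
for every `h ≥ 26` (`not_bp2_window_of_le`); hence `not_bp2_window`: for NO `h₀` does `∀ h ≥ h₀, ∀ n, bp2 (h²/4) (h³/8) h n` hold.

WHY NO WINDOW SURVIVES (memo HOME/val-np-p3/g21/MEMO-bpwindow-valnp3-g21.md §1–§3): rows may concentrate on a sub-cube `T ⊂ [h]`,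
`|T| = h'`, so at ambient `h` the bands of every `h' ≤ h` apply (rectangular form of the law: rank of the `≤5`-rows inside `T` is
`≤ b + b·N₂(h') − C(N₂(h'),2)`, the other rows add `≤ 1` each); band₂(h') ≈ (h'²/2 + 1.5h', h'³/60 + h'²/4) and the `q = 3` analogue
(`ShadowRank.det_eq_zero_triples`-type counts) starts near `b ≈ 1.2·10⁵`; every `b = c·h^k` is eventually inside some band. What dies
is PER-PIECE UNIFORMITY of complete blocks («BP»), i.e. the architecture `PairBall.exists_table` → `SimplexJoin.good_of_uniform_pieces_join`;
what survives is the JOIN (ranks ADD over pieces with independent tables: `2h` pair-ball pieces are never starved by these counts),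
node #1, and the item. WHAT THIS IS NOT: no statement about `bp2` on windows dodging the bands at a FIXED `h ≤ 27`
(e.g. `[456, 2460]` at `h = 27` has no known defect); nothing on crux 14610 or VP ≠ VNP.
-/

set_option linter.dupNamespace false

namespace Summit.ValiantsHypothesis.ValiantsHypothesis.Theorems.BarrierLever.HiddenStates

open Finset Matrix

noncomputable section

namespace PairBall

open PairBlock GreedyCut ShadowRank

/-! ## 1. Counting small sets -/

/-- `smallSets T q` is the union of the layers `T.powersetCard j`, `j ≤ q`. -/
theorem smallSets_eq_biUnion {h : ℕ} (T : Finset (Fin h)) (q : ℕ) :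
    smallSets T q = (Finset.range (q + 1)).biUnion fun j => T.powersetCard j := by
  ext V
  simp only [smallSets, Finset.mem_filter, Finset.mem_powerset, Finset.mem_biUnion, Finset.mem_range,
    Finset.mem_powersetCard]
  constructor
  · rintro ⟨hV, hc⟩
    exact ⟨V.card, Nat.lt_succ_of_le hc, hV, rfl⟩
  · rintro ⟨j, hj, hV, rfl⟩
    exact ⟨hV, Nat.le_of_lt_succ hj⟩

/-- The layers `T.powersetCard j` are pairwise disjoint. -/
theorem disjoint_powersetCard_of_ne {α : Type*} (T : Finset α) {j j' : ℕ} (hjj' : j ≠ j') :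
    Disjoint (T.powersetCard j) (T.powersetCard j') := by
  rw [Finset.disjoint_left]
  intro V hV hV'
  rw [Finset.mem_powersetCard] at hV hV'
  exact hjj' (hV.2.symm.trans hV'.2)

/-- `#{V ⊆ T : |V| ≤ q} = Σ_{j ≤ q} C(|T|, j)`. -/
theorem card_smallSets {h : ℕ} (T : Finset (Fin h)) (q : ℕ) :
    (smallSets T q).card = ∑ j ∈ Finset.range (q + 1), T.card.choose j := by
  rw [smallSets_eq_biUnion, Finset.card_biUnion]
  · exact Finset.sum_congr rfl fun j _ => Finset.card_powersetCard j T
  · intro j _ j' _ hjj'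
    exact disjoint_powersetCard_of_ne T hjj'

/-- `#{V ⊆ Fin h : |V| ≤ 2} = 1 + h + C(h,2)`. -/
theorem card_smallSets_univ_two (h : ℕ) :
    (smallSets (Finset.univ : Finset (Fin h)) 2).card = 1 + h + h.choose 2 := by
  rw [card_smallSets, Finset.card_univ, Fintype.card_fin]
  simp [Finset.sum_range_succ, Nat.choose_zero_right, Nat.choose_one_right]

/-- The nonempty subsets of `Fin h` of size `≤ 5`. -/
theorem card_filter_card_mem_Icc (h : ℕ) :
    ((Finset.univ : Finset (Finset (Fin h))).filter fun V => V.card ∈ Finset.Icc 1 5).card =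
      ∑ j ∈ Finset.Icc 1 5, h.choose j := by
  have hset : ((Finset.univ : Finset (Finset (Fin h))).filter fun V => V.card ∈ Finset.Icc 1 5) =
      (Finset.Icc 1 5).biUnion fun j => (Finset.univ : Finset (Fin h)).powersetCard j := by
    ext V
    simp only [Finset.mem_filter, Finset.mem_univ, true_and, Finset.mem_biUnion, Finset.mem_powersetCard,
      Finset.subset_univ]
    constructor
    · intro hV; exact ⟨V.card, hV, rfl⟩
    · rintro ⟨j, hj, rfl⟩; exact hj
  rw [hset, Finset.card_biUnion]
  · refine Finset.sum_congr rfl fun j _ => ?_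
    rw [Finset.card_powersetCard, Finset.card_univ, Fintype.card_fin]
  · intro j _ j' _ hjj'
    exact disjoint_powersetCard_of_ne _ hjj'

/-! ## 2. A base on the whole column set is a nonsingular matrix -/

/-- If `R` is a base for the FULL column block of a square matrix, the matrix is nonsingular. -/
theorem det_ne_zero_of_isBase_univ {n : ℕ} {N : Matrix (Fin n) (Fin n) ℂ} {R : Finset (Fin n)}
    (hR : IsBase N Finset.univ R) : N.det ≠ 0 := by
  classical
  have hRu : R = Finset.univ := Finset.eq_univ_of_card R (by rw [hR.1, Finset.card_univ])
  intro hdet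
  obtain ⟨v, hv0, hv⟩ := Matrix.exists_vecMul_eq_zero_iff.mpr hdet
  have hli : LinearIndepOn ℂ (rowVec N Finset.univ) ((Finset.univ : Finset (Fin n)) : Set (Fin n)) := hRu ▸ hR.2
  rw [Finset.coe_univ, linearIndepOn_univ_iff] at hli
  have hrel : ∑ i, v i • rowVec N Finset.univ i = 0 := by
    funext k
    have hk := congrFun hv k.1
    simp only [Matrix.vecMul, dotProduct, Pi.zero_apply] at hk
    simp only [Finset.sum_apply, Pi.smul_apply, smul_eq_mul, rowVec, Pi.zero_apply]
    exact hk
  exact hv0 (funext fun i => Fintype.linearIndependent_iff.mp hli v hrel i)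

/-! ## 3. The refutation schema -/

/-- **BP₂ dies on the five-row families.** If `N₂(h) = 1 + h + C(h,2) ≤ b`, `b + b·N₂(h) < (b + C(b,2)) + C(N₂(h),2)` and there
are at least `b + C(b,2)` nonempty subsets of `Fin h` of size `≤ 5`, then `PairBall.Stmt.bp2 β₁ β₂ h (b + C(b,2))` fails for every
window `β₁ ≤ b ≤ β₂`: the complete pair block on `b` states (no free states) against any `b + C(b,2)` distinct nonempty rows of size
`≤ 5` is singular for EVERY table by `ShadowRank.det_eq_zero_pairs` (`q = 2`, `s = 5`), while a base on the whole column set would make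
it nonsingular. -/
theorem not_bp2_of_pairLaw {β₁ β₂ h b : ℕ} (hβ₁ : β₁ ≤ b) (hβ₂ : b ≤ β₂) (hNb : 1 + h + h.choose 2 ≤ b)
    (hcount : b + b * (1 + h + h.choose 2) < b + b.choose 2 + (1 + h + h.choose 2).choose 2)
    (hrows : b + b.choose 2 ≤ ∑ j ∈ Finset.Icc 1 5, h.choose j) :
    ¬ Stmt.bp2 β₁ β₂ h (b + b.choose 2) := by
  classical
  intro hBP
  set n : ℕ := b + b.choose 2 with hn
  -- the columns: all singles and pairs of `Fin b`
  set S : Finset (Finset (Fin b)) := Finset.univ.filter fun J => J.card = 1 ∨ J.card = 2 with hS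
  have hScard : S.card = n := by
    have hsplit : S = (Finset.univ : Finset (Fin b)).powersetCard 1 ∪ (Finset.univ : Finset (Fin b)).powersetCard 2 := by
      ext J
      simp [hS, Finset.mem_powersetCard]
    rw [hsplit, Finset.card_union_of_disjoint (disjoint_powersetCard_of_ne _ (by norm_num)),
      Finset.card_powersetCard, Finset.card_powersetCard, Finset.card_univ, Fintype.card_fin, Nat.choose_one_right]
  obtain ⟨eS⟩ : Nonempty (Fin n ≃ ↥S) := by
    refine ⟨(Fintype.equivFinOfCardEq ?_).symm⟩
    rw [Fintype.card_coe, hScard]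
  let cols : Fin n → Finset (Fin b) := fun k => (eS k).1
  have hcols_mem : ∀ k, (cols k).card = 1 ∨ (cols k).card = 2 := fun k => (Finset.mem_filter.mp (eS k).2).2
  have hcols_inj : Function.Injective cols := fun k k' hkk' => eS.injective (Subtype.ext hkk')
  have hPB : IsPairBall cols (Finset.univ : Finset (Fin b)) :=
    ⟨hcols_inj, fun k => Or.inl ⟨Finset.subset_univ _, hcols_mem k⟩⟩
  have hC : IsComplete cols (Finset.univ : Finset (Fin b)) := by
    refine ⟨fun q _ => ?_, fun q _ q' _ hqq' => ?_⟩
    · have hq : ({q} : Finset (Fin b)) ∈ S := by rw [hS, Finset.mem_filter]; simp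
      exact ⟨eS.symm ⟨{q}, hq⟩, by simp [cols]⟩
    · have hq : ({q, q'} : Finset (Fin b)) ∈ S := by
        rw [hS, Finset.mem_filter]; simp [Finset.card_pair hqq']
      exact ⟨eS.symm ⟨{q, q'}, hq⟩, by simp [cols]⟩
  -- the rows: `n` distinct nonempty subsets of size `≤ 5`
  set Rw : Finset (Finset (Fin h)) := Finset.univ.filter fun V => V.card ∈ Finset.Icc 1 5 with hRw
  have hRwcard : n ≤ Rw.card := by rw [hRw, card_filter_card_mem_Icc]; exact hrows
  obtain ⟨eR⟩ : Nonempty (Fin n ↪ ↥Rw) := by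
    refine ⟨(Fin.castLEEmb ?_).trans (Fintype.equivFin ↥Rw).symm.toEmbedding⟩
    rw [Fintype.card_coe]; exact hRwcard
  let ℛ : Fin n → Finset (Fin h) := fun i => (eR i).1
  have hℛ_mem : ∀ i, 1 ≤ (ℛ i).card ∧ (ℛ i).card ≤ 5 := fun i =>
    Finset.mem_Icc.mp (Finset.mem_filter.mp (eR i).2).2
  have hℛinj : Function.Injective ℛ := fun i i' hii' => eR.injective (Subtype.ext hii')
  have hℛne : ∀ i, (ℛ i).Nonempty := fun i => Finset.card_pos.mp (hℛ_mem i).1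
  -- BP gives a table with a base on the whole column set
  obtain ⟨gB, R, hbase⟩ := hBP b cols Finset.univ hPB (by simpa using hβ₁)
    (by simpa using hβ₂) hC ℛ hℛinj hℛne
  have hPuniv : (Finset.univ.filter fun k : Fin n => cols k ⊆ (Finset.univ : Finset (Fin b))) = Finset.univ := by
    simp
  rw [hPuniv] at hbase
  have hdet : (cfgMat ℛ cols gB).det ≠ 0 := det_ne_zero_of_isBase_univ hbase
  -- the pair law makes the same matrix singular
  let tx : Option (Fin b) → Fin h → ℂ := fun o a => o.elim 0 (fun q => gB q a)
  have hmat : (Matrix.of fun i k : Fin n => ∏ a ∈ ℛ i, (tx none a + ∑ p ∈ cols k, tx (some p) a)) =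
      cfgMat ℛ cols gB := by
    refine Matrix.ext fun i k => ?_
    simp [cfgMat, tx]
  have hsingle : (Finset.univ.filter fun k : Fin n => (cols k).card ≠ 2).card ≤ b := by
    calc (Finset.univ.filter fun k : Fin n => (cols k).card ≠ 2).card
        = ((Finset.univ.filter fun k : Fin n => (cols k).card ≠ 2).image cols).card :=
          (Finset.card_image_of_injective _ hcols_inj).symm
      _ ≤ ((Finset.univ : Finset (Fin b)).powersetCard 1).card := by
          refine Finset.card_le_card fun J hJ => ?_
          rw [Finset.mem_image] at hJ
          obtain ⟨k, hk, rfl⟩ := hJ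
          rw [Finset.mem_filter] at hk
          rw [Finset.mem_powersetCard]
          exact ⟨Finset.subset_univ _, (hcols_mem k).resolve_right hk.2⟩
      _ = b := by rw [Finset.card_powersetCard, Finset.card_univ, Fintype.card_fin, Nat.choose_one_right]
  have hN : (smallSets (Finset.univ : Finset (Fin h)) 2).card = 1 + h + h.choose 2 := card_smallSets_univ_two h
  have hzero := ShadowRank.det_eq_zero_pairs ℛ cols (Finset.univ : Finset (Fin b)) (Finset.univ : Finset (Fin h)) 2 tx
    (s := 5) (by norm_num) (fun k _ => Finset.subset_univ _) (fun i => (hℛ_mem i).2) (fun i => Finset.subset_univ _)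
    (by rw [hN, Finset.card_univ, Fintype.card_fin]; exact hNb)
    (by
      rw [hN, Finset.card_univ, Fintype.card_fin, Fintype.card_fin]
      have := hcount
      omega)
  rw [hmat] at hzero
  exact hdet hzero

/-! ## 4. Arithmetic -/

/-- `2·C(n+1, 2) = (n+1)n`. -/
theorem two_mul_choose_two (n : ℕ) : 2 * (n + 1).choose 2 = (n + 1) * n := by
  have := Nat.add_one_mul_choose_eq n 1
  rw [Nat.choose_one_right] at this
  norm_num at this
  omega

/-- `6·C(n+2, 3) = (n+2)(n+1)n`. -/
theorem six_mul_choose_three (n : ℕ) : 6 * (n + 2).choose 3 = (n + 2) * (n + 1) * n := by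
  have h1 := Nat.add_one_mul_choose_eq (n + 1) 2
  have h2 := two_mul_choose_two n
  nlinarith [h1, h2]

/-- `24·C(n+3, 4) = (n+3)(n+2)(n+1)n`. -/
theorem mul_choose_four (n : ℕ) : 24 * (n + 3).choose 4 = (n + 3) * (n + 2) * (n + 1) * n := by
  have h1 := Nat.add_one_mul_choose_eq (n + 2) 3
  have h2 := six_mul_choose_three n
  nlinarith [h1, h2]

/-- `120·C(n+4, 5) = (n+4)(n+3)(n+2)(n+1)n`. -/
theorem mul_choose_five (n : ℕ) :
    120 * (n + 4).choose 5 = (n + 4) * (n + 3) * (n + 2) * (n + 1) * n := by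
  have h1 := Nat.add_one_mul_choose_eq (n + 3) 4
  have h2 := mul_choose_four n
  nlinarith [h1, h2]

/-- `Σ_{1 ≤ j ≤ 5} C(h,j)` spelled out. -/
theorem sum_Icc_one_five (h : ℕ) : ∑ j ∈ Finset.Icc 1 5, h.choose j =
    h.choose 1 + h.choose 2 + h.choose 3 + h.choose 4 + h.choose 5 := by
  rw [show Finset.Icc 1 5 = {1, 2, 3, 4, 5} from rfl]
  simp [Finset.sum_insert, add_assoc]

/-- Rows: for `h = k + 26` and `b = C(h,2) + 3h + 1` there are at least `b + C(b,2)` nonempty subsets of size `≤ 5`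
(`120·(Σ_{j≤5} C(h,j) − 1 − n) = k⁵ + 110k⁴ + 4555k³ + 84430k² + 601024k + 224520 ≥ 0`). -/
theorem rows_le (k : ℕ) :
    ((k + 26).choose 2 + 3 * (k + 26) + 1) + ((k + 26).choose 2 + 3 * (k + 26) + 1).choose 2 ≤
      ∑ j ∈ Finset.Icc 1 5, (k + 26).choose j := by
  rw [sum_Icc_one_five]
  have e2 : 2 * (k + 26).choose 2 = k ^ 2 + 51 * k + 650 := by
    rw [show k + 26 = k + 25 + 1 from rfl, two_mul_choose_two]; ring
  have e3 : 6 * (k + 26).choose 3 = k ^ 3 + 75 * k ^ 2 + 1874 * k + 15600 := by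
    rw [show k + 26 = k + 24 + 2 from rfl, six_mul_choose_three]; ring
  have e4 : 24 * (k + 26).choose 4 = k ^ 4 + 98 * k ^ 3 + 3599 * k ^ 2 + 58702 * k + 358800 := by
    rw [show k + 26 = k + 23 + 3 from rfl, mul_choose_four]; ring
  have e5 : 120 * (k + 26).choose 5 =
      k ^ 5 + 120 * k ^ 4 + 5755 * k ^ 3 + 137880 * k ^ 2 + 1650244 * k + 7893600 := by
    rw [show k + 26 = k + 22 + 4 from rfl, mul_choose_five]; ring
  have e1 : (k + 26).choose 1 = k + 26 := by rw [Nat.choose_one_right]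
  set c2 := (k + 26).choose 2 with hc2
  have hb : c2 + 3 * (k + 26) + 1 = c2 + 3 * k + 78 + 1 := by ring
  have ecb : 2 * (c2 + 3 * (k + 26) + 1).choose 2 =
      c2 ^ 2 + 6 * (k * c2) + 157 * c2 + 9 * k ^ 2 + 471 * k + 6162 := by
    rw [hb, two_mul_choose_two]; ring
  have e2k : 2 * (k * c2) = k ^ 3 + 51 * k ^ 2 + 650 * k := by
    have := congrArg (fun x => k * x) e2; linarith [this]
  have e2sq : 4 * c2 ^ 2 = k ^ 4 + 102 * k ^ 3 + 3901 * k ^ 2 + 66300 * k + 422500 := by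
    have := congrArg (fun x => x ^ 2) e2; nlinarith [this]
  have hk2 := Nat.zero_le (k ^ 2)
  have hk3 := Nat.zero_le (k ^ 3)
  have hk4 := Nat.zero_le (k ^ 4)
  have hk5 := Nat.zero_le (k ^ 5)
  linarith

/-- Count: `(b − N₂)² = 4h² > b + N₂` for `b = N₂ + 2h`. -/
theorem count_lt (k : ℕ) :
    ((k + 26).choose 2 + 3 * (k + 26) + 1) + ((k + 26).choose 2 + 3 * (k + 26) + 1) * (1 + (k + 26) + (k + 26).choose 2) <
      ((k + 26).choose 2 + 3 * (k + 26) + 1) + ((k + 26).choose 2 + 3 * (k + 26) + 1).choose 2 +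
        (1 + (k + 26) + (k + 26).choose 2).choose 2 := by
  have e2 : 2 * (k + 26).choose 2 = k ^ 2 + 51 * k + 650 := by
    rw [show k + 26 = k + 25 + 1 from rfl, two_mul_choose_two]; ring
  set c2 := (k + 26).choose 2 with hc2
  have hb : c2 + 3 * (k + 26) + 1 = c2 + 3 * k + 78 + 1 := by ring
  have hN : 1 + (k + 26) + c2 = c2 + k + 26 + 1 := by ring
  have ecb : 2 * (c2 + 3 * k + 78 + 1).choose 2 = (c2 + 3 * k + 78 + 1) * (c2 + 3 * k + 78) := by
    rw [two_mul_choose_two]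
  have ecN : 2 * (c2 + k + 26 + 1).choose 2 = (c2 + k + 26 + 1) * (c2 + k + 26) := by rw [two_mul_choose_two]
  rw [hb, hN]
  nlinarith [ecb, ecN, e2]

/-! ## 5. The window of record -/

/-- **For every `h ≥ 26`**, `b = C(h,2) + 3h + 1` refutes `bp2 β₁ β₂ h (b + C(b,2))` for every window `β₁ ≤ b ≤ β₂`. -/
theorem not_bp2_of_le {β₁ β₂ h : ℕ} (hh : 26 ≤ h) (hβ₁ : β₁ ≤ h.choose 2 + 3 * h + 1)
    (hβ₂ : h.choose 2 + 3 * h + 1 ≤ β₂) :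
    ¬ Stmt.bp2 β₁ β₂ h ((h.choose 2 + 3 * h + 1) + (h.choose 2 + 3 * h + 1).choose 2) := by
  obtain ⟨k, rfl⟩ : ∃ k, h = k + 26 := ⟨h - 26, by omega⟩
  exact not_bp2_of_pairLaw hβ₁ hβ₂ (by have := two_mul_choose_two (k + 25); omega) (count_lt k) (rows_le k)

/-- `b = C(h,2) + 3h + 1` lies in the window `[h²/4, h³/8]` for `h ≥ 26`. -/
theorem window_mem (k : ℕ) :
    (k + 26) * (k + 26) / 4 ≤ (k + 26).choose 2 + 3 * (k + 26) + 1 ∧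
      (k + 26).choose 2 + 3 * (k + 26) + 1 ≤ (k + 26) * (k + 26) * (k + 26) / 8 := by
  have e2 : 2 * (k + 26).choose 2 = k ^ 2 + 51 * k + 650 := by
    rw [show k + 26 = k + 25 + 1 from rfl, two_mul_choose_two]; ring
  have hsq : (k + 26) * (k + 26) = k ^ 2 + 52 * k + 676 := by ring
  have hcube : (k + 26) * (k + 26) * (k + 26) = k ^ 3 + 78 * k ^ 2 + 2028 * k + 17576 := by ring
  rw [hcube, hsq]
  constructor <;> omega

/-- **BP₂ on the window of record is false at every `h ≥ 26`**: `¬ bp2 (h²/4) (h³/8) h n` with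
`n = b + C(b,2)`, `b = C(h,2) + 3h + 1`. -/
theorem not_bp2_window_of_le {h : ℕ} (hh : 26 ≤ h) :
    ¬ Stmt.bp2 (h * h / 4) (h * h * h / 8) h ((h.choose 2 + 3 * h + 1) + (h.choose 2 + 3 * h + 1).choose 2) := by
  obtain ⟨k, rfl⟩ : ∃ k, h = k + 26 := ⟨h - 26, by omega⟩
  exact not_bp2_of_le (by omega) (window_mem k).1 (window_mem k).2

/-- **No tail of `h` carries BP₂ on the window `[h²/4, h³/8]`** (the hypothesis `∀ n, PairBall.Stmt.bp2 (h²/4) (h³/8) h n` of the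
arrow of record `PairBallMix.universalJoinWide_of_bp2_range`, rulings R52/R57, fails for every `h ≥ 24`; here: for every `h₀`
some `h ≥ h₀` and `n` violate it). -/
theorem not_bp2_window (h₀ : ℕ) : ¬ ∀ h : ℕ, h₀ ≤ h → ∀ n : ℕ, Stmt.bp2 (h * h / 4) (h * h * h / 8) h n := fun H =>
  not_bp2_window_of_le (h := max h₀ 26) (le_max_right _ _) (H (max h₀ 26) (le_max_left _ _) _)

/-! ## 6. The table heights `h = 24, 25, 26, 27` (where the lane's «(h, r) table through h = 27» invoked BP) -/

/-- `h = 24`, `b = 327 ∈ [144, 1728]`, `n = 53628 ≤ 55454` rows of size `≤ 5`, count `98754 < 98778`. -/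
theorem not_bp2_window_24 : ¬ Stmt.bp2 (24 * 24 / 4) (24 * 24 * 24 / 8) 24 (327 + (327 : ℕ).choose 2) :=
  not_bp2_of_pairLaw (by norm_num) (by norm_num) (by norm_num [Nat.choose_two_right]) (by norm_num [Nat.choose_two_right])
    (by rw [sum_Icc_one_five]; norm_num [Nat.choose_two_right, Nat.choose_eq_factorial_div_factorial, Nat.factorial])

/-- `h = 25`, `b = 353 ∈ [156, 1953]`. -/
theorem not_bp2_window_25 : ¬ Stmt.bp2 (25 * 25 / 4) (25 * 25 * 25 / 8) 25 (353 + (353 : ℕ).choose 2) :=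
  not_bp2_of_pairLaw (by norm_num) (by norm_num) (by norm_num [Nat.choose_two_right]) (by norm_num [Nat.choose_two_right])
    (by rw [sum_Icc_one_five]; norm_num [Nat.choose_two_right, Nat.choose_eq_factorial_div_factorial, Nat.factorial])

/-- `h = 26`, `b = 380 ∈ [169, 2197]`. -/
theorem not_bp2_window_26 : ¬ Stmt.bp2 (26 * 26 / 4) (26 * 26 * 26 / 8) 26 (380 + (380 : ℕ).choose 2) :=
  not_bp2_of_pairLaw (by norm_num) (by norm_num) (by norm_num [Nat.choose_two_right]) (by norm_num [Nat.choose_two_right])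
    (by rw [sum_Icc_one_five]; norm_num [Nat.choose_two_right, Nat.choose_eq_factorial_div_factorial, Nat.factorial])

/-- `h = 27`, `b = 408 ∈ [182, 2460]`. -/
theorem not_bp2_window_27 : ¬ Stmt.bp2 (27 * 27 / 4) (27 * 27 * 27 / 8) 27 (408 + (408 : ℕ).choose 2) :=
  not_bp2_of_pairLaw (by norm_num) (by norm_num) (by norm_num [Nat.choose_two_right]) (by norm_num [Nat.choose_two_right])
    (by rw [sum_Icc_one_five]; norm_num [Nat.choose_two_right, Nat.choose_eq_factorial_div_factorial, Nat.factorial])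

end PairBall

end

end Summit.ValiantsHypothesis.ValiantsHypothesis.Theorems.BarrierLever.HiddenStates
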